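import Mathlib.RingTheory.MvPolynomial.Homogeneous
import Mathlib.Algebra.MvPolynomial.Division
import Mathlib.RingTheory.Regular.RegularSequence
import Mathlib.Tactic.LinearCombination
import HarnessLib

/-!
# Quasi-regular sequences and Rees' theorem (Matsumura, §16, Thm. 16.2)

Topic: `Literature/AlgebraicGeometry/Resolution`. Support file for the discharge of the named fact
`Matsumura1987_19_4` ("a regular local ring is normal", `RegularLocalRings.lean`): the route
regular system of parameters ⇒ `A`-sequence ⇒ quasi-regular ⇒ `gr_𝔪(A) ≅ k[X₁, …, X_d]`
(Matsumura Thms. 17.8, 16.2, 17.10) needs the notion of a *quasi-regular sequence* and Rees'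
theorem that regular sequences are quasi-regular, neither of which is in Mathlib (quasi-regular
sequences are a TODO in `Mathlib/RingTheory/Regular/RegularSequence.lean`).

## Content (all for the module `M = A`, which is all the application needs)

* `exists_isHomogeneous_of_mem_mul_span_pow`, `eval_mem_mul_span_pow`: an element of
  `K · I^n`, `I = (a_1, …, a_n)`, is a form of degree `n` in the `a_i` with coefficients in `K`,
  and conversely (Matsumura's notation `F(a)`, `F ∈ A[X_1, …, X_n]` homogeneous).
* `IsQuasiRegular a` — Matsumura's definition (§16, p. 124 of the book = PDF p. 140): for every
  `ν`, if `F ∈ A[X]` is homogeneous of degree `ν` and `F(a) ∈ I^{ν+1}` then all coefficients of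
  `F` lie in `I`.
* `IsQuasiRegular.mem_pow_of_mul_mem_pow` — Thm. 16.2 (ii): if `a` is quasi-regular and
  `(I : x) = I` then `(I^ν : x) = I^ν` for all `ν`.
* `isQuasiRegular_of_regularSeq` — Thm. 16.2 (i) (Rees): an `A`-sequence `a : Fin k → A` is
  quasi-regular; the `A`-sequence condition (1) of §16 (book p. 123) is stated elementwise
  (`a_i` is a non-zero-divisor modulo `(a_j : j < i)`; condition (2), `(a) ≠ A`, is not needed).
  `isQuasiRegular_of_isWeaklyRegular` is the same with Mathlib's
  `RingTheory.Sequence.IsWeaklyRegular A (List.ofFn a)`.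

## Source

H. Matsumura, *Commutative Ring Theory*, CUP 1986, §16, Definition p. 124 and Theorem 16.2
p. 125 (PDF pp. 140–141), proof "taken from Rees". The Lean proof follows the printed proof
line by line (induction on the length, splitting `F = G(X_1..X_{n-1}) + X_n H`, the colon
property (ii) for the shorter sequence, induction on the degree).
-/

namespace Literature.AlgebraicGeometry.Resolution

universe u

open MvPolynomial

variable {R : Type u} [CommRing R]

/-! ## Forms of degree `n` in a sequence of elements -/

/-- An element of `K · (a)^n` is `F(a)` for a form `F` of degree `n` with coefficients in `K`
(Matsumura §16, the notation `F(a)`). [folklore] -/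
theorem exists_isHomogeneous_of_mem_mul_span_pow {ι : Type*} (x : ι → R) (K : Ideal R) :
    ∀ (n : ℕ) {y : R}, y ∈ K * Ideal.span (Set.range x) ^ n →
      ∃ F : MvPolynomial ι R, F.IsHomogeneous n ∧ F ∈ Ideal.map C K ∧ eval x F = y := by
  intro n
  induction n with
  | zero =>
    intro y hy
    rw [pow_zero, mul_one] at hy
    exact ⟨C y, isHomogeneous_C _ _, Ideal.mem_map_of_mem _ hy, eval_C _⟩
  | succ n ih =>
    intro y hy
    rw [pow_succ, ← mul_assoc] at hy
    refine Submodule.mul_induction_on hy ?_ ?_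
    · intro b hb c hc
      obtain ⟨F, hF, hFK, hFb⟩ := ih hb
      obtain ⟨p, hp, hpc⟩ := (Ideal.mem_span_iff_exists_isHomogeneous x c).mp hc
      refine ⟨F * p, hF.mul hp, Ideal.mul_mem_right _ _ hFK, ?_⟩
      rw [map_mul, hFb, hpc]
    · rintro y₁ y₂ ⟨F₁, hF₁, hF₁K, rfl⟩ ⟨F₂, hF₂, hF₂K, rfl⟩
      exact ⟨F₁ + F₂, hF₁.add hF₂, add_mem hF₁K hF₂K, map_add _ _ _⟩

/-- An element of `(a)^n` is `F(a)` for a form `F` of degree `n`. [folklore] -/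
theorem exists_isHomogeneous_of_mem_span_pow {ι : Type*} (x : ι → R) (n : ℕ) {y : R}
    (hy : y ∈ Ideal.span (Set.range x) ^ n) :
    ∃ F : MvPolynomial ι R, F.IsHomogeneous n ∧ eval x F = y :=
  (Ideal.mem_span_pow_iff_exists_isHomogeneous x y).mp hy

/-- Conversely, a form of degree `n` with coefficients in `K` evaluates into `K · (a)^n`.
[folklore] -/
theorem eval_mem_mul_span_pow {ι : Type*} (x : ι → R) {K : Ideal R} {n : ℕ}
    {F : MvPolynomial ι R} (hF : F.IsHomogeneous n) (hK : F ∈ Ideal.map C K) :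
    eval x F ∈ K * Ideal.span (Set.range x) ^ n := by
  rw [mem_map_C_iff] at hK
  rw [F.as_sum, map_sum]
  refine Submodule.sum_mem _ fun d hd => ?_
  have hdeg : d.degree = n := by
    rw [Finsupp.degree_eq_weight_one]
    exact hF (mem_support_iff.mp hd)
  have hmon : eval x (monomial d (1 : R)) ∈ Ideal.span (Set.range x) ^ n :=
    (Ideal.mem_span_pow_iff_exists_isHomogeneous x _).mpr
      ⟨monomial d 1, isHomogeneous_monomial _ hdeg, rfl⟩
  have : monomial d (coeff d F) = C (coeff d F) * monomial d 1 := by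
    rw [C_mul_monomial, mul_one]
  rw [this, map_mul, eval_C]
  exact Ideal.mul_mem_mul (hK d) hmon

/-- A form of degree `n` evaluates into `(a)^n`. [folklore] -/
theorem eval_mem_span_pow {ι : Type*} (x : ι → R) {n : ℕ} {F : MvPolynomial ι R}
    (hF : F.IsHomogeneous n) : eval x F ∈ Ideal.span (Set.range x) ^ n :=
  (Ideal.mem_span_pow_iff_exists_isHomogeneous x _).mpr ⟨F, hF, rfl⟩

/-! ## Quasi-regular sequences -/

/-- **Quasi-regular sequence** (Matsumura §16, Definition, book p. 124), for the module `M = A`: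
a family `a = (a_i)` of elements of `A`, `I = (a_i)`, is *quasi-regular* if for every `ν` and
every form `F ∈ A[X_i]` homogeneous of degree `ν`, `F(a) ∈ I^{ν+1}` implies that all the
coefficients of `F` lie in `I` (i.e. `F ∈ I·A[X]`). Equivalently the natural surjection
`(A/I)[X] → gr_I(A)` is an isomorphism. The book's standing assumption `IA ≠ A` is not bundled
(it plays no role in Thm. 16.2 (i), (ii)); the index type is arbitrary.
[cite: Matsumura1987, §16 Definition p. 124] -/
def IsQuasiRegular {ι : Type*} (x : ι → R) : Prop :=
  ∀ (n : ℕ) (F : MvPolynomial ι R), F.IsHomogeneous n →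
    eval x F ∈ Ideal.span (Set.range x) ^ (n + 1) →
      F ∈ Ideal.map (C : R →+* MvPolynomial ι R) (Ideal.span (Set.range x))

/-- Unfolding of `IsQuasiRegular` coefficientwise. [cite: Matsumura1987, §16 Definition p. 124] -/
theorem isQuasiRegular_def {ι : Type*} (x : ι → R) :
    IsQuasiRegular x ↔ ∀ (n : ℕ) (F : MvPolynomial ι R), F.IsHomogeneous n →
      eval x F ∈ Ideal.span (Set.range x) ^ (n + 1) →
        ∀ m, F.coeff m ∈ Ideal.span (Set.range x) := by
  simp only [IsQuasiRegular, mem_map_C_iff]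

/-- **Matsumura, Thm. 16.2 (ii)** (for `M = A`): if `a` is quasi-regular, `I = (a)`, and `x`
satisfies `(I : x) = I`, then `(I^ν : x) = I^ν` for every `ν`.
[cite: Matsumura1987, Thm. 16.2 (ii)] -/
theorem IsQuasiRegular.mem_pow_of_mul_mem_pow {ι : Type*} {x : ι → R} (hx : IsQuasiRegular x)
    {a : R} (ha : ∀ y, a * y ∈ Ideal.span (Set.range x) → y ∈ Ideal.span (Set.range x)) :
    ∀ (n : ℕ) {y : R}, a * y ∈ Ideal.span (Set.range x) ^ n → y ∈ Ideal.span (Set.range x) ^ n := by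
  intro n
  induction n with
  | zero => intro y _; simp
  | succ n ih =>
    intro y hy
    -- `y ∈ I^n` by induction, so `y = F(a)` with `F` a form of degree `n`
    have hy' : y ∈ Ideal.span (Set.range x) ^ n :=
      ih (Ideal.pow_le_pow_right (Nat.le_succ n) hy)
    obtain ⟨F, hF, rfl⟩ := exists_isHomogeneous_of_mem_span_pow x n hy'
    -- the coefficients of `a • F` lie in `I`, hence so do those of `F`
    have h1 : C a * F ∈ Ideal.map (C : R →+* MvPolynomial ι R) (Ideal.span (Set.range x)) :=
      hx n (C a * F) (hF.C_mul a) (by rwa [map_mul, eval_C])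
    have h2 : F ∈ Ideal.map (C : R →+* MvPolynomial ι R) (Ideal.span (Set.range x)) := by
      rw [mem_map_C_iff] at h1 ⊢
      intro m
      exact ha _ (by simpa only [coeff_C_mul] using h1 m)
    simpa only [← pow_succ'] using eval_mem_mul_span_pow x hF h2

/-! ## Rees' theorem: regular sequences are quasi-regular -/

/-- Binomial-type estimate used in Rees' proof: `(J + S)^{n+1} ⊆ J^{n+1} + S (J + S)^n`.
[folklore] -/
theorem sup_pow_succ_le (J S : Ideal R) (n : ℕ) :
    (J ⊔ S) ^ (n + 1) ≤ J ^ (n + 1) ⊔ S * (J ⊔ S) ^ n := by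
  induction n with
  | zero => simp
  | succ n ih =>
    calc (J ⊔ S) ^ (n + 1 + 1) = (J ⊔ S) * (J ⊔ S) ^ (n + 1) := pow_succ' _ _
      _ ≤ (J ⊔ S) * (J ^ (n + 1) ⊔ S * (J ⊔ S) ^ n) := Ideal.mul_mono_right ih
      _ = J * J ^ (n + 1) ⊔ J * (S * (J ⊔ S) ^ n) ⊔ (S * J ^ (n + 1) ⊔ S * (S * (J ⊔ S) ^ n)) := by
        rw [Ideal.sup_mul, Ideal.mul_sup, Ideal.mul_sup]
      _ ≤ J ^ (n + 1 + 1) ⊔ S * (J ⊔ S) ^ (n + 1) := by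
        refine sup_le (sup_le ?_ ?_) (sup_le ?_ ?_)
        · rw [← pow_succ']
          exact le_sup_left
        · refine le_sup_of_le_right ?_
          rw [mul_left_comm, pow_succ' (J ⊔ S) n]
          exact Ideal.mul_mono_right (Ideal.mul_mono_left le_sup_left)
        · refine le_sup_of_le_right (Ideal.mul_mono_right ?_)
          exact (Ideal.pow_right_mono le_sup_left _)
        · refine le_sup_of_le_right (Ideal.mul_mono_right ?_)
          rw [pow_succ' (J ⊔ S) n]
          exact Ideal.mul_mono_left le_sup_right

/-- The indices below the last one are the images of `Fin.castSucc`. [folklore] -/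
theorem Iio_last_eq_range_castSucc (k : ℕ) :
    Set.Iio (Fin.last k) = Set.range (Fin.castSucc : Fin k → Fin (k + 1)) := by
  ext i
  simp only [Set.mem_Iio, Set.mem_range, Fin.lt_last_iff_ne_last]
  exact (Fin.exists_castSucc_eq).symm

/-- `Fin.castSucc` maps initial segments to initial segments. [folklore] -/
theorem image_castSucc_Iio {k : ℕ} (i : Fin k) :
    (Fin.castSucc : Fin k → Fin (k + 1)) '' Set.Iio i = Set.Iio (Fin.castSucc i) := by
  ext j
  simp only [Set.mem_image, Set.mem_Iio]
  constructor
  · rintro ⟨j', hj', rfl⟩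
    exact Fin.castSucc_lt_castSucc_iff.mpr hj'
  · intro hj
    have hne : j ≠ Fin.last k := Fin.ne_last_of_lt hj
    obtain ⟨j', rfl⟩ := Fin.exists_castSucc_eq.mpr hne
    exact ⟨j', Fin.castSucc_lt_castSucc_iff.mp hj, rfl⟩

/-- **Matsumura, Thm. 16.2 (i)** (Rees), for `M = A`: an `A`-sequence `a_1, …, a_k` is
quasi-regular. The `A`-sequence hypothesis (§16 (1), book p. 123: "`a_1` is `A`-regular, `a_2`
is `A/a_1A`-regular, …") is stated elementwise — `a_i y ∈ (a_j : j < i)` implies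
`y ∈ (a_j : j < i)` — and condition (2) `(a) ≠ A` is not needed; see
`isQuasiRegular_of_isWeaklyRegular` for the same statement with Mathlib's `IsWeaklyRegular`.
[cite: Matsumura1987, Thm. 16.2 (i)] -/
theorem isQuasiRegular_of_regularSeq :
    ∀ (k : ℕ) (x : Fin k → R),
      (∀ (i : Fin k) (y : R), x i * y ∈ Ideal.span (x '' Set.Iio i) →
        y ∈ Ideal.span (x '' Set.Iio i)) → IsQuasiRegular x := by
  intro k
  induction k with
  | zero =>
    intro x _ n F _ hFx
    have hbot : Ideal.span (Set.range x) = ⊥ := by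
      rw [Set.range_eq_empty x, Ideal.span_empty]
    rw [hbot, Ideal.map_bot, Ideal.mem_bot]
    rw [hbot, Ideal.bot_pow (Nat.succ_ne_zero n), Ideal.mem_bot, F.eq_C_of_isEmpty, eval_C] at hFx
    rw [F.eq_C_of_isEmpty, hFx, C_0]
  | succ k ih =>
    intro x hreg
    -- notation: `x' = (a_1, …, a_k)`, `a = a_{k+1}`, `J = (x')`, `I = (x) = J + (a)`
    set x' : Fin k → R := x ∘ Fin.castSucc with hx'
    set a : R := x (Fin.last k) with ha_def
    set J : Ideal R := Ideal.span (Set.range x') with hJ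
    set I : Ideal R := Ideal.span (Set.range x) with hI
    have hIJ : I = J ⊔ Ideal.span {a} := by
      have : Set.range x = insert a (Set.range x') := by
        ext y
        simp only [Set.mem_range, Set.mem_insert_iff, hx', Function.comp_apply]
        rw [Fin.exists_fin_succ']
        constructor
        · rintro (⟨i, hi⟩ | h)
          · exact Or.inr ⟨i, hi⟩
          · exact Or.inl h.symm
        · rintro (h | ⟨i, hi⟩)
          · exact Or.inr h.symm
          · exact Or.inl ⟨i, hi⟩
      rw [hI, this, Ideal.span_insert, sup_comm]
    have hJI : J ≤ I := hIJ ▸ le_sup_left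
    have haI : a ∈ I := Ideal.subset_span ⟨Fin.last k, rfl⟩
    -- the shorter sequence is an `A`-sequence, hence quasi-regular by induction
    have hreg' : ∀ (i : Fin k) (y : R), x' i * y ∈ Ideal.span (x' '' Set.Iio i) →
        y ∈ Ideal.span (x' '' Set.Iio i) := by
      intro i y hy
      have himg : x' '' Set.Iio i = x '' Set.Iio (Fin.castSucc i) := by
        rw [hx', Set.image_comp, image_castSucc_Iio]
      rw [himg] at hy ⊢
      exact hreg (Fin.castSucc i) y hy
    have hQR' : IsQuasiRegular x' := ih x' hreg'
    -- `a` is a non-zero-divisor modulo `J`, hence `(J^ν : a) = J^ν` by Thm. 16.2 (ii)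
    have ha : ∀ y, a * y ∈ J → y ∈ J := by
      have himg : x '' Set.Iio (Fin.last k) = Set.range x' := by
        rw [Iio_last_eq_range_castSucc, ← Set.range_comp]
      intro y hy
      have := hreg (Fin.last k) y
      rw [himg] at this
      exact this hy
    have hcolon := hQR'.mem_pow_of_mul_mem_pow ha
    -- induction on the degree `ν`
    intro n
    induction n with
    | zero =>
      intro F hF hFx
      have hFC : F = C (coeff 0 F) :=
        totalDegree_eq_zero_iff_eq_C.mp ((totalDegree_zero_iff_isHomogeneous _).mpr hF)
      rw [hFC, eval_C, zero_add, pow_one] at hFx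
      rw [hFC]
      exact Ideal.mem_map_of_mem _ hFx
    | succ n ihn =>
      intro F hF hFx
      -- split `F = X_{k+1} H + G` with `G` not involving `X_{k+1}`
      set s : Fin (k + 1) →₀ ℕ := Finsupp.single (Fin.last k) 1 with hs
      set H := F.divMonomial s with hH_def
      set G := F.modMonomial s with hG_def
      have hsplit : X (Fin.last k) * H + G = F := F.divMonomial_add_modMonomial_single _
      have hH : H.IsHomogeneous n := by
        intro d hd
        rw [hH_def, coeff_divMonomial] at hd
        have h1 := hF hd
        have h2 : Finsupp.weight (1 : Fin (k + 1) → ℕ) s = 1 := by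
          simp [hs, Finsupp.weight_apply, Finsupp.sum_single_index]
        rw [map_add, h2] at h1
        omega
      have hG : G.IsHomogeneous (n + 1) := by
        intro d hd
        by_cases hsd : s ≤ d
        · exact absurd (coeff_modMonomial_of_le F hsd) hd
        · rw [hG_def, coeff_modMonomial_of_not_le F hsd] at hd
          exact hF hd
      obtain ⟨G', hG'⟩ : ∃ G' : MvPolynomial (Fin k) R, rename Fin.castSucc G' = G := by
        refine exists_rename_eq_of_vars_subset_range G _ (Fin.castSucc_injective k) ?_
        intro i hi
        rw [Finset.mem_coe, mem_vars_iff_mem_support] at hi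
        obtain ⟨d, hd, hid⟩ := hi
        rw [Set.mem_range, Fin.exists_castSucc_eq]
        rintro rfl
        have hsd : ¬ s ≤ d := fun hsd =>
          (mem_support_iff.mp hd) (coeff_modMonomial_of_le F hsd)
        rw [hs, Finsupp.single_le_iff] at hsd
        rw [Finsupp.mem_support_iff] at hid
        omega
      have hG'h : G'.IsHomogeneous (n + 1) :=
        (IsHomogeneous.rename_isHomogeneous_iff (Fin.castSucc_injective k)).mp (hG' ▸ hG)
      have hevF : eval x F = a * eval x H + eval x' G' := by
        rw [← hsplit, map_add, map_mul, eval_X, ← hG', eval_rename]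
      -- write `F(a) = w₁ + a w₂` with `w₁ ∈ J^{n+2}`, `w₂ ∈ I^{n+1}`
      have hFx' : eval x F ∈ J ^ (n + 1 + 1) ⊔ Ideal.span {a} * I ^ (n + 1) := by
        have := sup_pow_succ_le J (Ideal.span {a}) (n + 1)
        rw [← hIJ] at this
        exact this hFx
      obtain ⟨w₁, hw₁, t, ht, hsum⟩ := Submodule.mem_sup.mp hFx'
      obtain ⟨w₂, hw₂, rfl⟩ := Ideal.mem_span_singleton_mul.mp ht
      -- `a (H(a) - w₂) = w₁ - G'(a') ∈ J^{n+1}`, so `H(a) - w₂ ∈ J^{n+1}` by the colon property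
      have hu : eval x H - w₂ ∈ J ^ (n + 1) := by
        refine hcolon (n + 1) ?_
        have : a * (eval x H - w₂) = w₁ - eval x' G' := by
          rw [hevF] at hsum
          linear_combination -hsum
        rw [this]
        refine sub_mem (Ideal.pow_le_pow_right (Nat.le_succ _) hw₁) ?_
        exact eval_mem_span_pow x' hG'h
      -- hence `H(a) ∈ I^{n+1}` and, by induction on the degree, `H ∈ I·A[X]`
      have hHx : eval x H ∈ I ^ (n + 1) := by
        have := add_mem (Ideal.pow_right_mono hJI (n + 1) hu) hw₂
        simpa using this
      have hHI : H ∈ Ideal.map (C : R →+* MvPolynomial (Fin (k + 1)) R) I := ihn H hH hHx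
      -- `H(a) - w₂ = h(a')`, `w₁ = q(a')` with `h`, `q` forms of degree `n+1`, `q ∈ J·A[X]`
      obtain ⟨h, hh, -, hhx⟩ := exists_isHomogeneous_of_mem_mul_span_pow x' ⊤ (n + 1)
        (y := eval x H - w₂) (by simpa only [Ideal.top_mul] using hu)
      obtain ⟨q, hq, hqJ, hqx⟩ := exists_isHomogeneous_of_mem_mul_span_pow x' J (n + 1)
        (y := w₁) (show w₁ ∈ J * J ^ (n + 1) by rwa [← pow_succ'])
      -- `g = G' + a h - q` is a form of degree `n+1` in `X_1..X_k` with `g(a') = 0`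
      set g : MvPolynomial (Fin k) R := G' + C a * h - q with hg_def
      have hg : g.IsHomogeneous (n + 1) := (hG'h.add (hh.C_mul a)).sub hq
      have hgx : eval x' g = 0 := by
        simp only [hg_def, map_sub, map_add, map_mul, eval_C, hhx, hqx]
        rw [hevF] at hsum
        linear_combination -hsum
      have hgJ : g ∈ Ideal.map (C : R →+* MvPolynomial (Fin k) R) J :=
        hQR' (n + 1) g hg (by rw [hgx]; exact zero_mem _)
      -- so the coefficients of `G'` lie in `J + aA + J ⊆ I`
      have hG'I : G' ∈ Ideal.map (C : R →+* MvPolynomial (Fin k) R) I := by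
        have : G' = g - C a * h + q := by rw [hg_def]; ring
        rw [this]
        refine add_mem (sub_mem (Ideal.map_mono hJI hgJ) ?_) (Ideal.map_mono hJI hqJ)
        exact Ideal.mul_mem_right _ _ (Ideal.mem_map_of_mem _ haI)
      -- conclusion
      rw [← hsplit, ← hG']
      refine add_mem (Ideal.mul_mem_left _ _ hHI) ?_
      have := Ideal.mem_map_of_mem (rename (Fin.castSucc : Fin k → Fin (k + 1))).toRingHom hG'I
      rw [Ideal.map_map] at this
      have hcomp : (rename (Fin.castSucc : Fin k → Fin (k + 1))).toRingHom.comp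
          (C : R →+* MvPolynomial (Fin k) R) = C := by
        ext r
        simp
      rwa [hcomp] at this

/-- The elements of the first `i` entries of `List.ofFn x` are the `x j`, `j < i`. [folklore] -/
theorem setOf_mem_take_ofFn {α : Type*} {k : ℕ} (x : Fin k → α) (i : Fin k) :
    { r | r ∈ (List.ofFn x).take i } = x '' Set.Iio i := by
  ext r
  simp only [Set.mem_setOf_eq, List.mem_take_iff_getElem, List.getElem_ofFn, List.length_ofFn,
    Set.mem_image, Set.mem_Iio]
  constructor
  · rintro ⟨j, hj, rfl⟩
    refine ⟨⟨j, by omega⟩, ?_, rfl⟩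
    rw [Fin.lt_def]
    simp only
    omega
  · rintro ⟨j, hj, rfl⟩
    refine ⟨j, ?_, rfl⟩
    rw [Fin.lt_def] at hj
    omega

/-- **Matsumura, Thm. 16.2 (i)** (Rees) with Mathlib's notion of a weakly regular sequence
(`RingTheory.Sequence.IsWeaklyRegular`, i.e. an `A`-sequence without the condition `(a) ≠ A`):
a weakly `A`-regular sequence is quasi-regular. [cite: Matsumura1987, Thm. 16.2 (i)] -/
theorem isQuasiRegular_of_isWeaklyRegular {k : ℕ} (x : Fin k → R)
    (h : RingTheory.Sequence.IsWeaklyRegular R (List.ofFn x)) : IsQuasiRegular x := by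
  refine isQuasiRegular_of_regularSeq k x fun i y hy => ?_
  have hlen : (List.ofFn x).length = k := List.length_ofFn
  have := (RingTheory.Sequence.isWeaklyRegular_iff_Fin R (List.ofFn x)).mp h
    (Fin.cast hlen.symm i)
  rw [isSMulRegular_quotient_iff_mem_of_smul_mem] at this
  have key := this y
  simp only [Fin.getElem_fin, Fin.val_cast, List.getElem_ofFn, Fin.eta, smul_eq_mul,
    Ideal.mul_top] at key
  rw [Ideal.ofList, setOf_mem_take_ofFn] at key
  exact key hy

end Literature.AlgebraicGeometry.Resolution
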